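import Literature.AlgebraicTopology.SingularHomology.CupIProducts
import Literature.AlgebraicTopology.SingularHomology.CupProductSupports
import HarnessLib

/-!
# The Steenrod squares on singular cohomology with coefficients of characteristic two

N. E. Steenrod, *Products of cocycles and extensions of mappings*, Ann. of Math. 48 (1947),
§§5–6: for a cocycle `u ∈ Zᵖ(X; 𝔽₂)` the cochains `u ⌣ᵢ u` are cocycles whose classes depend
only on `[u]`, giving operations — in the modern (Serre/Mosher–Tangora) indexing —
`Sqᵏ : Hᵖ(X; 𝔽₂) → Hᵖ⁺ᵏ(X; 𝔽₂)`, `Sqᵏ[u] = [u ⌣_{p-k} u]`; A. Medina-Mardones, *New formulas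
for cup-i products and fast computation of Steenrod squares*, Comput. Geom. 109 (2023),
Def. 2: `Sqᵏ[α] = [(α ⊗ α)Δ_{p-k}]`, and the remark following it: `Sqᵏ[α] = [α][α]` for `α`
of degree `k`.

This file DEFINES the Steenrod squares on the tree's singular cohomology
`Literature.AlgebraicTopology.SingularHomology.singularCohomology R R X p` for every
commutative coefficient ring `R` of characteristic two, from the cup-`i` products and their
coboundary formula of `CupIProducts.lean`, and PROVES:

* `steenrodSqLower X p n i : Hᵖ(X; R) →+ Hⁿ(X; R)`, `[u] ↦ [u ⌣ᵢ u]` — Steenrod's original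
  lower-indexed `Sqᵢ : Hᵖ → H²ᵖ⁻ⁱ` with the output degree `n` explicit (zero unless
  `p + p = n + i`, `steenrodSqLower_eq_zero_of_ne`) — is well defined and additive
  (`π_lowerSqCocycles_eq_of_π_eq`: `u ⌣ᵢ u + (u + δc) ⌣ᵢ (u + δc) = δ(u ⌣ᵢ₊₁ δc + c ⌣ᵢ δc + c ⌣ᵢ₋₁ c)`;
  `π_lowerSqCocycles_add`: `u ⌣ᵢ v + v ⌣ᵢ u = δ(u ⌣ᵢ₊₁ v)` for cocycles), computed on
  representatives by `steenrodSqLower_π`, natural (`steenrodSqLower_map`); the upper-indexed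
  `steenrodSq X p k = steenrodSqLower X p (p + k) (p - k) : Hᵖ →+ Hᵖ⁺ᵏ`, `Sqᵏ[u] = [u ⌣_{p-k} u]`
  (`steenrodSq_π`) — the explicit-degree form is the one in which the commutation with
  connecting homomorphisms is stated without degree casts (sequel);
* `steenrodSq_self`: `Sqᵖ x = x ⌣ x` (the tree's `cupProduct`), via `⌣₀ = ⌣`;
* `steenrodSq_map`: naturality `f^* Sqᵏ = Sqᵏ f^*`;
* `steenrodSq_eq_zero_of_lt`: `Sqᵏ = 0` on `Hᵖ` for `k > p`;
* `steenrodSq_zero_apply(_zmod)`: `Sq⁰ = id` when `r² = r` in `R`, in particular over `ZMod 2`.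

## Design

Cochain identities are carried out on honest function types: `coboundary m c` is the singular
coboundary `d m (m+1)` read as a map `(SingularSimplex X m → R) → (SingularSimplex X (m+1) → R)`
and `coFn u` the cochain of a cocycle `u`, so that the algebra of cochains is that of the
function ring (where `linear_combination` applies); coboundaries of the previous degree are
transported through `(ComplexShape.up ℕ).prev` by `exists_d_prev_succ_iff` /
`d_prev_zero_eq_zero`, and classes are compared with `π_eq_zero_iff` (`CupProductSupports.lean`)
and `π_eq_π_of_exists_d_eq_add`. Over a general ring of characteristic two `Sqᵏ` is additive
but only Frobenius-semilinear (`Sqᵏ(r • x) = r² • Sqᵏ x`), hence bundled as `→+`.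

Deliberately NOT here: the Cartan formula, `Sq¹ = Bockstein`, the Adem relations, stability
of `Sqᵏ` under suspension / connecting homomorphisms, Wu classes and Wu's formula, Steenrod
squares in relative cohomology.

## References

* N. E. Steenrod, *Products of cocycles and extensions of mappings*, Ann. of Math. (2) 48
  (1947), 290–320, §§5–7. [Steenrod1947]
* A. M. Medina-Mardones, *New formulas for cup-i products and fast computation of Steenrod
  squares*, Comput. Geom. 109 (2023), 101921 (arXiv:2105.08025), Def. 2, Ex. 8–9, Lemma 12.
  [Medinamardones2023]
* A. Hatcher, *Algebraic Topology*, CUP 2002, §3.1 (cochains, cohomology classes), §4.L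
  (properties of Steenrod squares). [Hatcher2002]
-/

noncomputable section

open CategoryTheory Finset

universe u v

namespace Literature.AlgebraicTopology.SingularHomology

variable {R : Type v} [CommRing R]
variable {X Y : Type u} [TopologicalSpace X] [TopologicalSpace Y]
variable {p q n m : ℕ}

open CategoryTheory singularCochainComplex

/-! ### Cochains as functions: the coboundary `coboundary` and the cochain `coFn u` of a cocycle -/

/-- The singular coboundary `δ : Cᵐ → Cᵐ⁺¹` as a map between the function types
`(SingularSimplex X m → R) → (SingularSimplex X (m+1) → R)` (Hatcher 2002, §3.1); it is
`(singularCochainComplex R R X).d m (m + 1)` with source and target displayed as functions.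
[folklore] -/
def coboundary (m : ℕ) (c : SingularSimplex X m → R) : SingularSimplex X (m + 1) → R :=
  (singularCochainComplex R R X).d m (m + 1) c

/-- `coboundary` is the coboundary `d`. [folklore] -/
lemma coboundary_eq (c : SingularSimplex X m → R) :
    coboundary m c = (singularCochainComplex R R X).d m (m + 1) c := rfl

/-- `δ` is additive. [folklore] -/
@[simp] lemma coboundary_add (c c' : SingularSimplex X m → R) : coboundary m (c + c') = coboundary m c + coboundary m c' :=
  ((singularCochainComplex R R X).d m (m + 1)).hom.map_add c c'

/-- `δ 0 = 0`. [folklore] -/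
@[simp] lemma coboundary_zero : coboundary m (0 : SingularSimplex X m → R) = 0 :=
  ((singularCochainComplex R R X).d m (m + 1)).hom.map_zero

/-- `δ δ = 0`. [folklore] -/
@[simp] lemma coboundary_coboundary (c : SingularSimplex X m → R) : coboundary (m + 1) (coboundary m c) = 0 := by
  unfold coboundary
  rw [← ModuleCat.comp_apply, HomologicalComplex.d_comp_d]
  rfl

/-- The cochain of a cocycle, as a function `SingularSimplex X p → R` (this is `iCocycles`,
displayed as a function). [folklore] -/
def coFn (u : cocycles R R X p) : SingularSimplex X p → R := iCocycles R R X p u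

/-- `coFn u = iCocycles u`. [folklore] -/
lemma coFn_eq (u : cocycles R R X p) : coFn u = iCocycles R R X p u := rfl

/-- The cochain of a cocycle is a cocycle: `δ(coFn u) = 0`. [folklore] -/
@[simp] lemma coboundary_coFn (u : cocycles R R X p) : coboundary p (coFn u) = 0 :=
  d_iCocycles _ u

/-- `coFn (u + v) = coFn u + coFn v`. [folklore] -/
@[simp] lemma coFn_add (u v : cocycles R R X p) : coFn (u + v) = coFn u + coFn v :=
  (iCocycles R R X p).hom.map_add u v

/-- `coFn 0 = 0`. [folklore] -/
@[simp] lemma coFn_zero : coFn (0 : cocycles R R X p) = 0 :=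
  (iCocycles R R X p).hom.map_zero

/-- `coFn` is injective (cocycles are determined by their cochains). [folklore] -/
lemma coFn_injective : Function.Injective (coFn : cocycles R R X p → SingularSimplex X p → R) :=
  fun _ _ h => cocycles_ext h

/-- `coFn (f^♯ u) = f^♯ (coFn u)`. [folklore] -/
lemma coFn_cocyclesMap (f : C(X, Y)) (u : cocycles R R Y p) :
    coFn (cocyclesMap R R f p u) = (singularCochainComplex.map R R f).f p (coFn u) :=
  iCocycles_cocyclesMap f u

/-- `coFn (cocyclesMk φ h) = φ`. [folklore] -/
@[simp] lemma coFn_cocyclesMk (φ : SingularSimplex X p → R)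
    (h : (singularCochainComplex R R X).d p (p + 1) φ = 0) : coFn (cocyclesMk φ h) = φ :=
  iCocycles_mk φ h

/-- `coFn (toCocycles m (m+1) c) = δc`. [folklore] -/
@[simp] lemma coFn_toCocycles (c : SingularSimplex X m → R) :
    coFn (toCocycles R R X m (m + 1) c) = coboundary m c :=
  iCocycles_toCocycles m (m + 1) c

/-- In characteristic two, `x + x = 0` in every `R`-module. [folklore] -/
lemma add_self_of_charTwo [CharP R 2] {M : Type*} [AddCommGroup M] [Module R M] (x : M) :
    x + x = 0 := by
  rw [← two_smul R x, CharTwo.two_eq_zero, zero_smul]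

/-- In characteristic two, `φ + φ = 0` for cochains. [folklore] -/
lemma add_self_cochain [CharP R 2] (φ : SingularSimplex X n → R) : φ + φ = 0 :=
  funext fun _ => CharTwo.add_self_eq_zero _

/-- Transport of `∃ w ∈ C^{prev (m+1)}, δw = z` to `∃ w ∈ Cᵐ, δw = z` (the previous degree of
`m + 1` in the cochain complex shape is `m`). [folklore] -/
lemma exists_d_prev_succ_iff (z : SingularSimplex X (m + 1) → R) :
    (∃ w : (singularCochainComplex R R X).X ((ComplexShape.up ℕ).prev (m + 1)),
        (singularCochainComplex R R X).d _ (m + 1) w = z) ↔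
      ∃ w : SingularSimplex X m → R, coboundary m w = z := by
  have key : ∀ k : ℕ, k = m →
      ((∃ w : (singularCochainComplex R R X).X k,
        (singularCochainComplex R R X).d k (m + 1) w = z) ↔
        ∃ w : SingularSimplex X m → R, coboundary m w = z) := by
    rintro k rfl; exact Iff.rfl
  exact key _ (CochainComplex.prev_nat_succ m)

/-- In degree `0` there are no coboundaries: `d : C^{prev 0} → C⁰` vanishes. [folklore] -/
lemma d_prev_zero_eq_zero (w : (singularCochainComplex R R X).X ((ComplexShape.up ℕ).prev 0)) :
    (singularCochainComplex R R X).d _ 0 w = 0 := by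
  rw [(singularCochainComplex R R X).shape _ _ (by simp)]
  rfl

/-- Every singular cohomology class is represented by a cocycle (`π` is onto). [folklore] -/
lemma π_surjective (M : Type v) [AddCommGroup M] [Module R M] (n : ℕ) :
    Function.Surjective (singularCohomology.π R M X n) := by
  intro x
  induction x using singularCohomology_induction_on with
  | h a => exact ⟨a, rfl⟩

/-- Two cocycles whose cochains differ by a coboundary have the same class; characteristic-two
form `δw = z₁ + z₂ ⟹ [z₁] = [z₂]` (Hatcher 2002, §3.1). [folklore] -/
lemma π_eq_π_of_exists_d_eq_add [CharP R 2] {N : ℕ} (z₁ z₂ : cocycles R R X N)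
    (h : ∃ w : (singularCochainComplex R R X).X ((ComplexShape.up ℕ).prev N),
      (singularCochainComplex R R X).d _ N w = iCocycles R R X N z₁ + iCocycles R R X N z₂) :
    singularCohomology.π R R X N z₁ = singularCohomology.π R R X N z₂ := by
  obtain ⟨w, hw⟩ := h
  have hz : z₁ = z₂ + toCocycles R R X _ N w := by
    refine cocycles_ext ?_
    rw [map_add, iCocycles_toCocycles, hw, add_comm, add_assoc, add_self_of_charTwo (R := R),
      add_zero]
  rw [hz, map_add, π_toCocycles, add_zero]

/-! ### Cochain-level identities for the square `a ↦ a ⌣ᵢ a` (characteristic two) -/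

section CharTwoCochain

variable [CharP R 2]

omit [CharP R 2] in
/-- The cup-`i` products into degree `n < i` vanish. [cite: Steenrod1947, §5] -/
lemma cochainCupI_eq_zero_of_lt {i : ℕ} (h : n < i) (φ : SingularSimplex X p → R)
    (ψ : SingularSimplex X q → R) : cochainCupI n i φ ψ = 0 := by
  refine funext fun σ ↦ ?_
  rw [cochainCupI_apply]
  refine sum_eq_zero fun U hU => ?_
  exfalso
  rw [mem_cupIDomain] at hU
  omega

/-- Coboundary formula, function form: `δ(φ ⌣ᵢ₊₁ ψ) = δφ ⌣ᵢ₊₁ ψ + φ ⌣ᵢ₊₁ δψ + φ ⌣ᵢ ψ + ψ ⌣ᵢ φ`.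
[cite: Steenrod1947, Thm. 5.1] -/
lemma coboundary_cochainCupI_succ (i : ℕ) (φ : SingularSimplex X p → R) (ψ : SingularSimplex X q → R) :
    coboundary n (cochainCupI n (i + 1) φ ψ) =
      cochainCupI (n + 1) (i + 1) (coboundary p φ) ψ + cochainCupI (n + 1) (i + 1) φ (coboundary q ψ) +
        cochainCupI (n + 1) i φ ψ + cochainCupI (n + 1) i ψ φ :=
  d_cochainCupI_succ i φ ψ

/-- Leibniz rule for `⌣₀`, function form. [cite: Medinamardones2023, Lemma 13] -/
lemma coboundary_cochainCupI_zero (φ : SingularSimplex X p → R) (ψ : SingularSimplex X q → R) :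
    coboundary n (cochainCupI n 0 φ ψ) =
      cochainCupI (n + 1) 0 (coboundary p φ) ψ + cochainCupI (n + 1) 0 φ (coboundary q ψ) :=
  d_cochainCupI_zero φ ψ

/-- `δ(a ⌣ᵢ a) = δa ⌣ᵢ a + a ⌣ᵢ δa` for every `i` (the terms `a ⌣ᵢ₋₁ a + a ⌣ᵢ₋₁ a` cancel in
characteristic two). [cite: Steenrod1947, Thm. 5.1] -/
lemma coboundary_cochainCupI_self (i : ℕ) (a : SingularSimplex X p → R) :
    coboundary n (cochainCupI n i a a) =
      cochainCupI (n + 1) i (coboundary p a) a + cochainCupI (n + 1) i a (coboundary p a) := by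
  cases i with
  | zero => exact coboundary_cochainCupI_zero a a
  | succ j => rw [coboundary_cochainCupI_succ, add_assoc, add_self_cochain, add_zero]

/-- The square of a cocycle is a cocycle: `δ(a ⌣ᵢ a) = 0` if `δa = 0`. [cite: Steenrod1947, §5] -/
lemma coboundary_cochainCupI_self_eq_zero (i : ℕ) {a : SingularSimplex X p → R} (ha : coboundary p a = 0) :
    coboundary n (cochainCupI n i a a) = 0 := by
  rw [coboundary_cochainCupI_self, ha, map_zero, LinearMap.zero_apply, map_zero, add_zero]

/-- In degree `0` the symmetrised cup-`i` product vanishes. [folklore] -/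
lemma cochainCupI_symm_deg_zero (i : ℕ) (a b : SingularSimplex X p → R) :
    cochainCupI 0 i a b + cochainCupI 0 i b a = 0 := by
  rcases Nat.eq_zero_or_pos i with rfl | hi
  · rcases Nat.eq_zero_or_pos p with rfl | hp
    · refine funext fun σ ↦ ?_
      change cochainCupI 0 0 a b σ + cochainCupI 0 0 b a σ = 0
      rw [cochainCupI_self_apply, cochainCupI_self_apply, mul_comm, CharTwo.add_self_eq_zero]
    · rw [cochainCupI_eq_zero_of_ne (by omega), cochainCupI_eq_zero_of_ne (by omega), add_zero]
  · rw [cochainCupI_eq_zero_of_lt hi, cochainCupI_eq_zero_of_lt hi, add_zero]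

omit [CharP R 2] in
/-- In degree `0` the cup-`i` square of a cochain of positive degree vanishes. [folklore] -/
lemma cochainCupI_self_deg_zero (i : ℕ) (b : SingularSimplex X (m + 1) → R) :
    cochainCupI 0 i b b = 0 := by
  rcases Nat.eq_zero_or_pos i with rfl | hi
  · exact cochainCupI_eq_zero_of_ne (by omega) b b
  · exact cochainCupI_eq_zero_of_lt hi b b

/-- **The symmetrised cup-`i` product of cocycles is a coboundary**:
`a ⌣ᵢ b + b ⌣ᵢ a = δ(a ⌣ᵢ₊₁ b)` for `δa = δb = 0` (Steenrod 1947, Thm. 5.1 with cocycles;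
this gives the additivity of `Sqᵏ`). [cite: Steenrod1947, Thm. 5.1] -/
lemma exists_d_eq_cochainCupI_symm (n i : ℕ) {a b : SingularSimplex X p → R} (ha : coboundary p a = 0)
    (hb : coboundary p b = 0) :
    ∃ w : (singularCochainComplex R R X).X ((ComplexShape.up ℕ).prev n),
      (singularCochainComplex R R X).d _ n w = cochainCupI n i a b + cochainCupI n i b a := by
  cases n with
  | zero => exact ⟨0, by rw [map_zero, cochainCupI_symm_deg_zero]; rfl⟩
  | succ n' =>
    rw [exists_d_prev_succ_iff]
    refine ⟨cochainCupI n' (i + 1) a b, ?_⟩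
    rw [coboundary_cochainCupI_succ, ha, hb, map_zero, LinearMap.zero_apply, map_zero, zero_add, zero_add]

/-- **Changing the representative** (Steenrod 1947, §6; the square passes to cohomology): for
`δa = 0` and any cochain `c`, `a ⌣ᵢ a + (a + δc) ⌣ᵢ (a + δc) = δw` for some `w`
(namely `w = a ⌣ᵢ₊₁ δc + c ⌣ᵢ δc + c ⌣ᵢ₋₁ c`). [cite: Steenrod1947, §6] -/
lemma exists_d_eq_cochainCupI_add_coboundary_self (n i : ℕ) {a : SingularSimplex X (m + 1) → R}
    (ha : coboundary (m + 1) a = 0) (c : SingularSimplex X m → R) :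
    ∃ w : (singularCochainComplex R R X).X ((ComplexShape.up ℕ).prev n),
      (singularCochainComplex R R X).d _ n w =
        cochainCupI n i a a + cochainCupI n i (a + coboundary m c) (a + coboundary m c) := by
  have hexp : cochainCupI n i a a + cochainCupI n i (a + coboundary m c) (a + coboundary m c) =
      (cochainCupI n i a (coboundary m c) + cochainCupI n i (coboundary m c) a) +
        cochainCupI n i (coboundary m c) (coboundary m c) := by
    rw [map_add (cochainCupI n i) a (coboundary m c), LinearMap.add_apply,
      map_add (cochainCupI n i a), map_add (cochainCupI n i (coboundary m c))]
    linear_combination add_self_cochain (cochainCupI n i a a)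
  rw [hexp]
  obtain ⟨w₁, hw₁⟩ := exists_d_eq_cochainCupI_symm n i ha (coboundary_coboundary c)
  cases n with
  | zero => exact ⟨w₁, by rw [hw₁, cochainCupI_self_deg_zero, add_zero]⟩
  | succ n' =>
    obtain ⟨w₁', hw₁'⟩ := (exists_d_prev_succ_iff _).1 ⟨w₁, hw₁⟩
    rw [exists_d_prev_succ_iff]
    cases i with
    | zero =>
      refine ⟨w₁' + cochainCupI n' 0 c (coboundary m c), ?_⟩
      rw [coboundary_add, hw₁', coboundary_cochainCupI_zero, coboundary_coboundary, map_zero, add_zero]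
    | succ j =>
      refine ⟨w₁' + (cochainCupI n' (j + 1) c (coboundary m c) + cochainCupI n' j c c), ?_⟩
      rw [coboundary_add, coboundary_add, hw₁', coboundary_cochainCupI_succ, coboundary_coboundary, map_zero, add_zero,
        coboundary_cochainCupI_self]
      linear_combination add_self_cochain (cochainCupI (n' + 1) j c (coboundary m c)) +
        add_self_cochain (cochainCupI (n' + 1) j (coboundary m c) c)

end CharTwoCochain

/-! ### Steenrod's lower-indexed squares `Sqᵢ[u] = [u ⌣ᵢ u]` and the Steenrod squares `Sqᵏ` -/

section Steenrod

variable [CharP R 2]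

/-- **Steenrod's square on cocycles**, lower indexing with explicit output degree:
`u ↦ u ⌣ᵢ u ∈ Zⁿ` for `u ∈ Zᵖ` (meaningful for `p + p = n + i`, zero otherwise; Steenrod 1947,
§§5–6: `Sqᵢ : Hᵖ → H²ᵖ⁻ⁱ`). [cite: Steenrod1947, §6] -/
def lowerSqCocycles (n i : ℕ) (u : cocycles R R X p) : cocycles R R X n :=
  cocyclesMk (cochainCupI n i (coFn u) (coFn u)) (by
    have h := coboundary_cochainCupI_self_eq_zero (n := n) i (coboundary_coFn u)
    unfold coboundary at h
    exact h)

/-- The cochain of `lowerSqCocycles n i u` is `coFn u ⌣ᵢ coFn u`. [folklore] -/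
@[simp] lemma coFn_lowerSqCocycles (n i : ℕ) (u : cocycles R R X p) :
    coFn (lowerSqCocycles n i u) = cochainCupI n i (coFn u) (coFn u) := by
  rw [lowerSqCocycles, coFn_cocyclesMk]

/-- `lowerSqCocycles n i 0 = 0`. [folklore] -/
@[simp] lemma lowerSqCocycles_zero (n i : ℕ) : lowerSqCocycles n i (0 : cocycles R R X p) = 0 :=
  coFn_injective (by
    rw [coFn_lowerSqCocycles, coFn_zero, coFn_zero]
    refine funext fun σ ↦ ?_
    rw [cochainCupI_apply]
    exact sum_eq_zero fun _ _ => by simp)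

/-- **The square passes to cohomology**: cohomologous cocycles have cohomologous squares
(Steenrod 1947, §6). [cite: Steenrod1947, §6] -/
lemma π_lowerSqCocycles_eq_of_π_eq (n i : ℕ) {u u' : cocycles R R X p}
    (h : singularCohomology.π R R X p u = singularCohomology.π R R X p u') :
    singularCohomology.π R R X n (lowerSqCocycles n i u) =
      singularCohomology.π R R X n (lowerSqCocycles n i u') := by
  have h0 : singularCohomology.π R R X p (u + u') = 0 := by
    rw [map_add, h, add_self_of_charTwo (R := R)]
  obtain ⟨w, hw⟩ := (π_eq_zero_iff R (u + u')).1 h0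
  cases p with
  | zero =>
    rw [d_prev_zero_eq_zero] at hw
    have huu' : u + u' = 0 := cocycles_ext (by rw [← hw, map_zero])
    have : u = u' := by
      calc u = u + (u' + u') := by rw [add_self_of_charTwo (R := R), add_zero]
        _ = u' := by rw [← add_assoc, huu', zero_add]
    rw [this]
  | succ m =>
    obtain ⟨c, hc⟩ := (exists_d_prev_succ_iff _).1 ⟨w, hw⟩
    have hc' : coFn u' = coFn u + coboundary m c := by
      rw [hc, show (iCocycles R R X (m + 1) (u + u') : SingularSimplex X (m + 1) → R) =
        coFn u + coFn u' from coFn_add u u', ← add_assoc, add_self_cochain, zero_add]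
    refine π_eq_π_of_exists_d_eq_add _ _ ?_
    obtain ⟨w', hw'⟩ := exists_d_eq_cochainCupI_add_coboundary_self n i (coboundary_coFn u) c
    refine ⟨w', ?_⟩
    rw [hw']
    change cochainCupI n i (coFn u) (coFn u) + cochainCupI n i (coFn u + coboundary m c)
        (coFn u + coboundary m c) = coFn (lowerSqCocycles n i u) + coFn (lowerSqCocycles n i u')
    rw [coFn_lowerSqCocycles, coFn_lowerSqCocycles, hc']

/-- Additivity on cocycles: `[(u + v) ⌣ᵢ (u + v)] = [u ⌣ᵢ u] + [v ⌣ᵢ v]` (the cross terms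
`u ⌣ᵢ v + v ⌣ᵢ u` are a coboundary). [cite: Steenrod1947, Thm. 5.1] -/
lemma π_lowerSqCocycles_add (n i : ℕ) (u v : cocycles R R X p) :
    singularCohomology.π R R X n (lowerSqCocycles n i (u + v)) =
      singularCohomology.π R R X n (lowerSqCocycles n i u) +
        singularCohomology.π R R X n (lowerSqCocycles n i v) := by
  rw [← map_add]
  refine π_eq_π_of_exists_d_eq_add _ _ ?_
  obtain ⟨w, hw⟩ := exists_d_eq_cochainCupI_symm n i (coboundary_coFn u) (coboundary_coFn v)
  refine ⟨w, ?_⟩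
  rw [hw]
  change _ = coFn (lowerSqCocycles n i (u + v)) + coFn (lowerSqCocycles n i u + lowerSqCocycles n i v)
  rw [coFn_add, coFn_lowerSqCocycles, coFn_lowerSqCocycles, coFn_lowerSqCocycles, coFn_add,
    map_add (cochainCupI n i) (coFn u) (coFn v), LinearMap.add_apply,
    map_add (cochainCupI n i (coFn u)), map_add (cochainCupI n i (coFn v))]
  linear_combination (-1 : SingularSimplex X n → R) *
    add_self_cochain (cochainCupI n i (coFn u) (coFn u)) +
    (-1 : SingularSimplex X n → R) * add_self_cochain (cochainCupI n i (coFn v) (coFn v))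

variable (p) in
/-- `Sqᵢ` as a function on classes (via a chosen representative). [folklore] -/
def lowerSqClass (n i : ℕ) (x : singularCohomology R R X p) : singularCohomology R R X n :=
  singularCohomology.π R R X n (lowerSqCocycles n i (Classical.choose (π_surjective R p x)))

/-- `lowerSqClass n i [u] = [u ⌣ᵢ u]`. [cite: Steenrod1947, §6] -/
lemma lowerSqClass_π (n i : ℕ) (u : cocycles R R X p) :
    lowerSqClass p n i (singularCohomology.π R R X p u) =
      singularCohomology.π R R X n (lowerSqCocycles n i u) :=
  π_lowerSqCocycles_eq_of_π_eq n i
    (Classical.choose_spec (π_surjective R p (singularCohomology.π R R X p u)))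

variable (X p) in
/-- **Steenrod's lower-indexed square** `Sqᵢ : Hᵖ(X; R) → Hⁿ(X; R)`, `[u] ↦ [u ⌣ᵢ u]`, with the
output degree `n` explicit (the map is zero unless `p + p = n + i`); `R` of characteristic two
(Steenrod 1947, §6, the operations `Sqᵢ : Hᵖ → H²ᵖ⁻ⁱ`; in the modern upper indexing
`Sqᵏ = Sq_{p-k}`, see `steenrodSq`). An additive map. [cite: Steenrod1947, §6] -/
def steenrodSqLower (n i : ℕ) : singularCohomology R R X p →+ singularCohomology R R X n where
  toFun := lowerSqClass p n i
  map_zero' := by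
    rw [← map_zero (ConcreteCategory.hom (singularCohomology.π R R X p)), lowerSqClass_π,
      lowerSqCocycles_zero, map_zero]
  map_add' x y := by
    induction x using singularCohomology_induction_on with
    | h u =>
      induction y using singularCohomology_induction_on with
      | h v => rw [← map_add, lowerSqClass_π, lowerSqClass_π, lowerSqClass_π, π_lowerSqCocycles_add]

/-- **`Sqᵢ` on representatives**: `Sqᵢ[u] = [u ⌣ᵢ u]`. [cite: Steenrod1947, §6] -/
@[simp] lemma steenrodSqLower_π (n i : ℕ) (u : cocycles R R X p) :
    steenrodSqLower X p n i (singularCohomology.π R R X p u) =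
      singularCohomology.π R R X n (lowerSqCocycles n i u) :=
  lowerSqClass_π n i u

/-- **Naturality** of `Sqᵢ`: `f^* ∘ Sqᵢ = Sqᵢ ∘ f^*` (Steenrod 1947, §7; Medina-Mardones 2023,
Lemma 12). [cite: Medinamardones2023, Lemma 12] -/
theorem steenrodSqLower_map (f : C(X, Y)) (n i : ℕ) (x : singularCohomology R R Y p) :
    singularCohomology.map R R f n (steenrodSqLower Y p n i x) =
      steenrodSqLower X p n i (singularCohomology.map R R f p x) := by
  induction x using singularCohomology_induction_on with
  | h u =>
    rw [steenrodSqLower_π, singularCohomology.map_π, singularCohomology.map_π, steenrodSqLower_π]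
    congr 1
    refine coFn_injective ?_
    rw [coFn_cocyclesMap, coFn_lowerSqCocycles, coFn_lowerSqCocycles, coFn_cocyclesMap,
      cochainCupI_map]

/-- `Sqᵢ : Hᵖ → Hⁿ` vanishes unless `p + p = n + i`. [cite: Steenrod1947, §6] -/
theorem steenrodSqLower_eq_zero_of_ne {n i : ℕ} (h : p + p ≠ n + i)
    (x : singularCohomology R R X p) : steenrodSqLower X p n i x = 0 := by
  induction x using singularCohomology_induction_on with
  | h u =>
    rw [steenrodSqLower_π, ← map_zero (ConcreteCategory.hom (singularCohomology.π R R X n))]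
    congr 1
    refine coFn_injective ?_
    rw [coFn_lowerSqCocycles, coFn_zero, cochainCupI_eq_zero_of_ne h]

/-! #### The upper-indexed Steenrod squares `Sqᵏ = Sq_{p-k} : Hᵖ → Hᵖ⁺ᵏ` -/

/-- `Sqᵏ` on cocycles: `u ↦ u ⌣_{p-k} u ∈ Zᵖ⁺ᵏ` (Steenrod 1947, §§5–6; Medina-Mardones 2023,
Def. 2: `Sqᵏ[α] = [(α ⊗ α)Δ_{p-k}]`). [cite: Medinamardones2023, Def. 2] -/
abbrev sqCocycles (k : ℕ) (u : cocycles R R X p) : cocycles R R X (p + k) :=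
  lowerSqCocycles (p + k) (p - k) u

/-- The cochain of `sqCocycles k u` is `coFn u ⌣_{p-k} coFn u`. [folklore] -/
lemma coFn_sqCocycles (k : ℕ) (u : cocycles R R X p) :
    coFn (sqCocycles k u) = cochainCupI (p + k) (p - k) (coFn u) (coFn u) :=
  coFn_lowerSqCocycles _ _ u

variable (X p) in
/-- **The Steenrod square** `Sqᵏ : Hᵖ(X; R) → Hᵖ⁺ᵏ(X; R)` for a coefficient ring `R` of
characteristic two (Steenrod 1947, §§5–6; Medina-Mardones 2023, Def. 2): `Sqᵏ = Sq_{p-k}`,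
`Sqᵏ[u] = [u ⌣_{p-k} u]` (`steenrodSq_π`), an additive map; `Sqᵖ x = x ⌣ x`
(`steenrodSq_self`), natural (`steenrodSq_map`), zero for `k > p` (`steenrodSq_eq_zero_of_lt`).
Over a general ring of characteristic two `Sqᵏ` is only additive (`Sqᵏ(r • x) = r² • Sqᵏ x`);
over `𝔽₂` it is linear. Deliberately NOT here: the Cartan formula, `Sq¹ = β`, the Adem relations,
stability under suspension. [cite: Steenrod1947, §6] [cite: Medinamardones2023, Def. 2] -/
abbrev steenrodSq (k : ℕ) : singularCohomology R R X p →+ singularCohomology R R X (p + k) :=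
  steenrodSqLower X p (p + k) (p - k)

/-- **`Sqᵏ` on representatives**: `Sqᵏ[u] = [u ⌣_{p-k} u]`. [cite: Steenrod1947, §6] -/
lemma steenrodSq_π (k : ℕ) (u : cocycles R R X p) :
    steenrodSq X p k (singularCohomology.π R R X p u) =
      singularCohomology.π R R X (p + k) (sqCocycles k u) :=
  steenrodSqLower_π _ _ u

/-- **`Sqᵖ` is the cup square**: `Sqᵖ x = x ⌣ x` for `x ∈ Hᵖ` (Medina-Mardones 2023, Rem. after
Def. 2: "if `[α]` is of degree `-k` then `Sqᵏ([α]) = [α][α]`", with Ex. 8, `⌣₀ = ⌣`; in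
Steenrod's 1947 indexing this is `Sq₀`). [cite: Medinamardones2023, Def. 2 and Ex. 8] -/
theorem steenrodSq_self (x : singularCohomology R R X p) :
    steenrodSq X p p x = cupProduct rfl x x := by
  induction x using singularCohomology_induction_on with
  | h u =>
    rw [steenrodSq_π, cupProduct_π_π]
    congr 1
    refine coFn_injective ?_
    rw [coFn_sqCocycles, Nat.sub_self, cochainCupI_zero_eq_cochainCup rfl]
    exact (iCocycles_cocyclesCup rfl u u).symm

/-- **Naturality of the Steenrod squares**: `f^* ∘ Sqᵏ = Sqᵏ ∘ f^*` (Steenrod 1947, §7;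
Medina-Mardones 2023, Lemma 12). [cite: Medinamardones2023, Lemma 12] -/
theorem steenrodSq_map (f : C(X, Y)) (k : ℕ) (x : singularCohomology R R Y p) :
    singularCohomology.map R R f (p + k) (steenrodSq Y p k x) =
      steenrodSq X p k (singularCohomology.map R R f p x) :=
  steenrodSqLower_map f _ _ x

/-- **`Sqᵏ = 0` on `Hᵖ` for `k > p`**. [cite: Steenrod1947, §5] -/
theorem steenrodSq_eq_zero_of_lt {k : ℕ} (h : p < k) (x : singularCohomology R R X p) :
    steenrodSq X p k x = 0 :=
  steenrodSqLower_eq_zero_of_ne (by omega) x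

/-- **`Sq⁰ = id`** when the coefficients satisfy `r² = r` (e.g. `R = 𝔽₂`): `u ⌣ₚ u = u`
pointwise (Steenrod 1947, §5; Medina-Mardones 2023, Ex. 9). [cite: Medinamardones2023, Ex. 9] -/
theorem steenrodSq_zero_apply (hR : ∀ r : R, r * r = r) (x : singularCohomology R R X p) :
    steenrodSq X p 0 x = x := by
  induction x using singularCohomology_induction_on with
  | h u =>
    rw [steenrodSq_π]
    congr 1
    refine coFn_injective ?_
    rw [coFn_sqCocycles, Nat.sub_zero]
    exact funext fun σ => by
      change cochainCupI p p (coFn u) (coFn u) σ = coFn u σ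
      rw [cochainCupI_self_apply, hR]

/-- `Sq⁰ = id` over `𝔽₂ = ZMod 2`. [cite: Medinamardones2023, Ex. 9] -/
theorem steenrodSq_zero_apply_zmod {X : Type} [TopologicalSpace X] {p : ℕ}
    (x : singularCohomology (ZMod 2) (ZMod 2) X p) : steenrodSq X p 0 x = x :=
  steenrodSq_zero_apply (fun r => by fin_cases r <;> rfl) x

end Steenrod

end Literature.AlgebraicTopology.SingularHomology
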